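import Summits.SmoothPoincare4.SmoothPoincare4.Theses.AlgebraicDegree
import Literature.Geometry.Riemannian.LowEntropyHypersurfacesFourProofs
import HarnessLib.Audit.Check

/-!
# Line `birth` — BC3 skeleton for crux `AlgebraicDegree.QuarticRung` (stmt-SmoothPoincare4-3399)

Crux (fixed, never restated): every homotopy 4-sphere `S` smoothly embedded in `ℝ⁵` onto the
NONSINGULAR zero set `Z(f)` of a real polynomial `f` of total degree `≤ 4` is diffeomorphic to `S⁴`.

The line is the route's own certification mechanism (support item `PathCertificate`, "rigid isotopy
along a bounded nonsingular polynomial path") turned into a proof skeleton of the quartic rung —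
NORMALISE → CHAMBER → STAR → ROUND, each arrow a bounded nonsingular polynomial path
`G ∈ ℝ[t, x₁, …, x₅]`, the embedding being TRANSPORTED along each path by Ehresmann's flow, and the
round sphere recognised at the end by the tree's PROVED
`Literature.Geometry.Riemannian.nonempty_diffeomorph_sphere_four_of_range_eq_sphere`:

* `stub_pathTransport` (L, theorem-level: Ehresmann / isotopy extension for the proper submersion
  `t` on `{G = 0} ∩ [0,1] × ℝ⁵`): if the slices `Z(G(t,·))`, `t ∈ [0,1]`, are nonsingular and
  uniformly bounded and `S` is embedded onto `Z(G(1,·))`, then `S` is embedded onto `Z(G(0,·))`.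
  (`PathCertificate` = this stub + the round recognition theorem.)
* `stub_toDefiniteTop` (M/L, theorem-level: compactness of `Z(f) = e(S)` ⇒ `f` has a sign `σ`
  outside a ball ⇒ `σf₄ ≥ 0`; then `G = σf + (1 - t)ε|x|⁴` is a bounded nonsingular path from
  `Z(f)` (slice 1) to `Z(g)`, `g = σf + ε|x|⁴` (slice 0), whose top form `σf₄ + ε|x|⁴` is
  POSITIVE DEFINITE; `ε(R⁴ + 4R³) < min_{σf ≤ 0} (|∇(σf)| + |σf|)`).  The normalisation that puts
  the hypersurface in the open semialgebraic set of PD-top nonsingular quartics (where "bounded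
  zero set" is automatic and uniform on compact paths).
* `stub_definiteToStar` — THE BET (XL, open; the rigid-isotopy content of the rung): a PD-top
  nonsingular quartic `g` whose zero set carries an embedded homotopy 4-sphere is joined, through
  bounded nonsingular polynomials OF x-DEGREE ≤ 4 (`weightedTotalDegree (0,1,1,1,1,1) G ≤ 4`), to a
  star level `{p = 1}`, `p` a positive definite quartic FORM.  Equivalently: the sphere-carrying
  PD-top nonsingular quartics of `ℝ⁵` all lie in the rigid-isotopy chamber of `|x|⁴ - 1`
  ("Hilbert XVI, part I, for spheres among real quartic fourfolds": one chamber).  Strictly STRONGER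
  than the crux at degree 4 (it asserts rigid isotopy, not diffeomorphism) and structurally
  different: a statement about connected components of an open semialgebraic subset of `ℝ¹²⁶`,
  finitely many chambers, decidable chamber by chamber (CAD + certified topology), refutable by
  exhibiting TWO sphere chambers.  Why it might fail: several rigid-isotopy classes of sphere
  quartics (unknown already for quartic threefolds; cubic fourfolds are the last classified degree,
  FinashinKharlamov2008; Kharlamov's non-rigidly-isotopic quartic SURFACES of equal topology occur
  only for many-component M-type schemes, the one-sphere scheme is a single class in degrees ≤ 4,
  dimensions ≤ 3).  Sources: LerarioStecconi2021 (arXiv:2010.14553) §4.2, Krasnov2006,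
  FinashinKharlamov2008, BochnakCosteRoy1998 ch. 2 (semialgebraic paths), AkbulutKing1992.
* `stub_starToRound` (M, theorem-level: `G = (1-t)(|x|⁴ - 1) + t(p - 1) = q_t - 1` with
  `q_t = (1-t)|x|⁴ + tp` a PD quartic form; Euler's identity `∑ xᵢ ∂ᵢ q_t = 4 q_t = 4` on the
  slice gives nonsingularity, `q_t ≥ min(1, min_{S⁴} p)·|x|⁴` gives the uniform bound, and
  `{|x|⁴ = 1}` is the unit sphere): every star level `{p = 1}` is joined to the round sphere.

Composition `QuarticRung_of` (kernel-checked, no `sorry` of its own): normalise (`stub_toDefiniteTop`)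
and transport; chamber-to-star (`stub_definiteToStar`) and transport; star-to-round
(`stub_starToRound`) and transport; conclude by `nonempty_diffeomorph_sphere_four_of_range_eq_sphere`.
Every stub is used BY NAME; `sorryAx` enters only through `stub_*`.

Degree cases need no separate stub: `deg f ∈ {0, 1, 3}` is impossible for a compact nonempty
nonsingular `Z(f)` and is absorbed by `stub_toDefiniteTop` (its construction is degree-blind);
the quadric rung (support `QuadricRung`) is the special case `g = σf + ε|x|⁴` with `f` an ellipsoid.

Disproof / Negative lemmas honoured: none exist for this crux (`ledger crux ls`: no workfiles; no
`Theorems/QuarticRung/Negative`); `ledger negatives --problem SmoothPoincare4` has no statement on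
real algebraic hypersurfaces.  No stub is an instance of a refuted statement.
-/

noncomputable section

set_option linter.dupNamespace false

open scoped Manifold ContDiff Topology
open Set Function

namespace Summit.SmoothPoincare4.SmoothPoincare4.Cruxes.QuarticRung.Birth

/-- **Stub 1 (transport along a bounded nonsingular polynomial path; L, theorem-level).**
Let `G ∈ ℝ[t, x₁, …, x₅]` (`MvPolynomial (Fin 6) ℝ`, variable `0` is `t`).  If for every
`t ∈ [0,1]` the slice `Z(G(t,·)) ⊂ ℝ⁵` is nonsingular (some `∂G/∂xᵢ ≠ 0` at each of its points) and
the slices are uniformly bounded, and a homotopy 4-sphere `S` is smoothly embedded onto the slice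
`Z(G(1,·))`, then `S` is smoothly embedded onto the slice `Z(G(0,·))`.  Proof route: the compact set
`K = {G = 0} ∩ [0,1] × ℝ⁵` lies in the open set where `∇ₓG ≠ 0`; the horizontal field
`V = (1, -∂ₜG ∇ₓG / |∇ₓG|²)`, cut off outside a neighbourhood of `K`, is complete and tangent to
`{G = 0}` near `K`; its time-`(-1)` flow restricted to the slice `t = 1` is a diffeomorphism from a
neighbourhood of `Z(G(1,·))` in `ℝ⁵` onto a neighbourhood of `Z(G(0,·))` carrying the one zero set
onto the other, and composing it with `e` gives the required embedding (Ehresmann's fibration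
theorem for the proper submersion `t`, Bröcker–Jänich (8.12), in its smooth form; the tree's
`Literature.AlgebraicTopology.Homotopy.ehresmann_fibration_holds` is the homeomorphic-fibre version).
Leans on: Mathlib ODE/flow API or a direct construction; `Manifold.IsSmoothEmbedding`.
Support item `PathCertificate` (stmt-SmoothPoincare4-3404) is this stub followed by
`Literature.Geometry.Riemannian.nonempty_diffeomorph_sphere_four_of_range_eq_sphere`. -/
theorem stub_pathTransport :
    ∀ (S : Literature.Topology.FourManifolds.HomotopySphere 4) (G : MvPolynomial (Fin 6) ℝ)
      (e : S.carrier → EuclideanSpace ℝ (Fin 5)),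
      (∀ t ∈ Set.Icc (0 : ℝ) 1, ∀ x : EuclideanSpace ℝ (Fin 5),
        MvPolynomial.eval (Fin.cons t (WithLp.ofLp x) : Fin 6 → ℝ) G = 0 →
          ∃ i : Fin 5, MvPolynomial.eval (Fin.cons t (WithLp.ofLp x) : Fin 6 → ℝ)
            (MvPolynomial.pderiv i.succ G) ≠ 0) →
      (∃ R : ℝ, ∀ t ∈ Set.Icc (0 : ℝ) 1, ∀ x : EuclideanSpace ℝ (Fin 5),
        MvPolynomial.eval (Fin.cons t (WithLp.ofLp x) : Fin 6 → ℝ) G = 0 → ‖x‖ ≤ R) →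
      Manifold.IsSmoothEmbedding (𝓡 4) (𝓡 5) ∞ e →
      Set.range e = {x : EuclideanSpace ℝ (Fin 5) |
        MvPolynomial.eval (Fin.cons 1 (WithLp.ofLp x) : Fin 6 → ℝ) G = 0} →
      ∃ e' : S.carrier → EuclideanSpace ℝ (Fin 5),
        Manifold.IsSmoothEmbedding (𝓡 4) (𝓡 5) ∞ e' ∧
        Set.range e' = {x : EuclideanSpace ℝ (Fin 5) |
          MvPolynomial.eval (Fin.cons 0 (WithLp.ofLp x) : Fin 6 → ℝ) G = 0} := by
  sorry

/-- **Stub 2 (normalisation to a positive definite top form; M/L, theorem-level).**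
For the crux data — `f` of total degree `≤ 4` with nonsingular zero set `Z(f)` onto which a
homotopy 4-sphere `S` is smoothly embedded (so `Z(f)` is compact and nonempty) — there are a bounded
nonsingular polynomial path `G` and a polynomial `g` of total degree `≤ 4` such that: slice `1` of
`G` has zero set `Z(f)`, slice `0` has zero set `Z(g)`, the degree-4 homogeneous component of `g` is
POSITIVE DEFINITE, and `Z(g)` is nonsingular.  Proof route: `Z(f)` compact ⇒ `f` has a constant
sign `σ` outside a ball `B_R` (`ℝ⁵ ∖ B_R` is connected) ⇒ `σ·f₄ ≥ 0` (else `σf → -∞` along a ray)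
and `{σf ≤ 0} ⊆ B_R` is compact; put `g := σf + ε|x|⁴`, `G := σf + (1 - t)ε|x|⁴`
(`|x|⁴ = (∑ xᵢ²)²`): every slice has its zeros in `{σf ≤ 0} ⊆ B_R`, and for
`ε(R⁴ + 4R³) < μ := min_{σf ≤ 0} (|∇(σf)| + |σf|)` (positive since `Z(f)` is nonsingular) every
slice is nonsingular; `top(g) = σf₄ + ε|x|⁴` is positive definite.  Degree-blind (it also disposes
of `deg f ≤ 3`).  Leans on: `MvPolynomial.homogeneousComponent`, `MvPolynomial.totalDegree`,
compactness of `S.carrier`, `IsCompact.exists_isMinOn`, connectedness of the complement of a ball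
in `ℝ⁵`.  Sources: BochnakCosteRoy1998 §2; LerarioStecconi2021 §2 (discriminant / regular
polynomials). -/
theorem stub_toDefiniteTop :
    ∀ (S : Literature.Topology.FourManifolds.HomotopySphere 4) (f : MvPolynomial (Fin 5) ℝ)
      (e : S.carrier → EuclideanSpace ℝ (Fin 5)),
      f.totalDegree ≤ 4 →
      (∀ x : EuclideanSpace ℝ (Fin 5), MvPolynomial.eval (WithLp.ofLp x) f = 0 →
        ∃ i : Fin 5, MvPolynomial.eval (WithLp.ofLp x) (MvPolynomial.pderiv i f) ≠ 0) →
      Manifold.IsSmoothEmbedding (𝓡 4) (𝓡 5) ∞ e →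
      Set.range e = {x : EuclideanSpace ℝ (Fin 5) | MvPolynomial.eval (WithLp.ofLp x) f = 0} →
      ∃ (G : MvPolynomial (Fin 6) ℝ) (g : MvPolynomial (Fin 5) ℝ),
        (∀ t ∈ Set.Icc (0 : ℝ) 1, ∀ x : EuclideanSpace ℝ (Fin 5),
          MvPolynomial.eval (Fin.cons t (WithLp.ofLp x) : Fin 6 → ℝ) G = 0 →
            ∃ i : Fin 5, MvPolynomial.eval (Fin.cons t (WithLp.ofLp x) : Fin 6 → ℝ)
              (MvPolynomial.pderiv i.succ G) ≠ 0) ∧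
        (∃ R : ℝ, ∀ t ∈ Set.Icc (0 : ℝ) 1, ∀ x : EuclideanSpace ℝ (Fin 5),
          MvPolynomial.eval (Fin.cons t (WithLp.ofLp x) : Fin 6 → ℝ) G = 0 → ‖x‖ ≤ R) ∧
        {x : EuclideanSpace ℝ (Fin 5) |
            MvPolynomial.eval (Fin.cons 1 (WithLp.ofLp x) : Fin 6 → ℝ) G = 0} =
          {x : EuclideanSpace ℝ (Fin 5) | MvPolynomial.eval (WithLp.ofLp x) f = 0} ∧
        {x : EuclideanSpace ℝ (Fin 5) |
            MvPolynomial.eval (Fin.cons 0 (WithLp.ofLp x) : Fin 6 → ℝ) G = 0} =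
          {x : EuclideanSpace ℝ (Fin 5) | MvPolynomial.eval (WithLp.ofLp x) g = 0} ∧
        g.totalDegree ≤ 4 ∧
        (∀ x : EuclideanSpace ℝ (Fin 5), x ≠ 0 →
          0 < MvPolynomial.eval (WithLp.ofLp x) (MvPolynomial.homogeneousComponent 4 g)) ∧
        (∀ x : EuclideanSpace ℝ (Fin 5), MvPolynomial.eval (WithLp.ofLp x) g = 0 →
          ∃ i : Fin 5, MvPolynomial.eval (WithLp.ofLp x) (MvPolynomial.pderiv i g) ≠ 0) := by
  sorry

/-- **Stub 3 — THE BET (one rigid-isotopy chamber of sphere quartics; XL, open).**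
Let `g` have total degree `≤ 4`, POSITIVE DEFINITE degree-4 component and nonsingular zero set
`Z(g)`, and let a homotopy 4-sphere `S` be smoothly embedded onto `Z(g)`.  Then there are a
positive definite quartic FORM `p` and a polynomial path `G(t, x)` OF DEGREE ≤ 4 IN `x`
(`weightedTotalDegree (0,1,1,1,1,1) G ≤ 4`: every slice is a quartic) with nonsingular, uniformly
bounded slices on `[0,1]`, slice `1` having zero set `Z(g)` and slice `0` the star level `{p = 1}`.
Equivalently (polynomial approximation of semialgebraic paths in the OPEN set of PD-top nonsingular
quartics, BochnakCosteRoy1998 ch. 2; all `{p = 1}` lie in one chamber by `stub_starToRound`): every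
sphere-carrying PD-top nonsingular quartic of `ℝ⁵` lies in the rigid-isotopy chamber of `|x|⁴ - 1`.
STRONGER than the crux at degree 4 (rigid isotopy, not diffeomorphism) and of a different nature —
connectedness of a union of the finitely many chambers of an open semialgebraic subset of `ℝ¹²⁶`,
decidable chamber by chamber; the sign structure is forced (`g < 0` inside, `> 0` outside, by
Jordan–Brouwer and nonsingularity), so no hidden sign obstruction.  Why it might fail: two
rigid-isotopy classes of sphere quartic fourfolds (open already for quartic threefolds; cubic
fourfolds are the last classified degree, FinashinKharlamov2008; for curves and K3 quartic surfaces
the one-sphere scheme is a single class).  An exotic sphere of isotopy degree 4 would refute it too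
(it implies the crux).  Sources: LerarioStecconi2021 (arXiv:2010.14553) §4.2 (chambers of the
discriminant complement, bound `2T(2T-1)^{l-1}`), Krasnov2006, FinashinKharlamov2008,
BochnakCosteRoy1998, AkbulutKing1992.  Cheapest falsifier: a lattice count — two non-isomorphic
real structures on `H⁴` of a quartic fourfold compatible with `ℝX = S⁴ ⊂ ℝ⁵ ⊂ ℝP⁵`. -/
theorem stub_definiteToStar :
    ∀ (S : Literature.Topology.FourManifolds.HomotopySphere 4) (g : MvPolynomial (Fin 5) ℝ)
      (e : S.carrier → EuclideanSpace ℝ (Fin 5)),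
      g.totalDegree ≤ 4 →
      (∀ x : EuclideanSpace ℝ (Fin 5), x ≠ 0 →
        0 < MvPolynomial.eval (WithLp.ofLp x) (MvPolynomial.homogeneousComponent 4 g)) →
      (∀ x : EuclideanSpace ℝ (Fin 5), MvPolynomial.eval (WithLp.ofLp x) g = 0 →
        ∃ i : Fin 5, MvPolynomial.eval (WithLp.ofLp x) (MvPolynomial.pderiv i g) ≠ 0) →
      Manifold.IsSmoothEmbedding (𝓡 4) (𝓡 5) ∞ e →
      Set.range e = {x : EuclideanSpace ℝ (Fin 5) | MvPolynomial.eval (WithLp.ofLp x) g = 0} →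
      ∃ (G : MvPolynomial (Fin 6) ℝ) (p : MvPolynomial (Fin 5) ℝ),
        p.IsHomogeneous 4 ∧
        (∀ x : EuclideanSpace ℝ (Fin 5), x ≠ 0 → 0 < MvPolynomial.eval (WithLp.ofLp x) p) ∧
        (∀ t ∈ Set.Icc (0 : ℝ) 1, ∀ x : EuclideanSpace ℝ (Fin 5),
          MvPolynomial.eval (Fin.cons t (WithLp.ofLp x) : Fin 6 → ℝ) G = 0 →
            ∃ i : Fin 5, MvPolynomial.eval (Fin.cons t (WithLp.ofLp x) : Fin 6 → ℝ)
              (MvPolynomial.pderiv i.succ G) ≠ 0) ∧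
        (∃ R : ℝ, ∀ t ∈ Set.Icc (0 : ℝ) 1, ∀ x : EuclideanSpace ℝ (Fin 5),
          MvPolynomial.eval (Fin.cons t (WithLp.ofLp x) : Fin 6 → ℝ) G = 0 → ‖x‖ ≤ R) ∧
        {x : EuclideanSpace ℝ (Fin 5) |
            MvPolynomial.eval (Fin.cons 1 (WithLp.ofLp x) : Fin 6 → ℝ) G = 0} =
          {x : EuclideanSpace ℝ (Fin 5) | MvPolynomial.eval (WithLp.ofLp x) g = 0} ∧
        {x : EuclideanSpace ℝ (Fin 5) |
            MvPolynomial.eval (Fin.cons 0 (WithLp.ofLp x) : Fin 6 → ℝ) G = 0} =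
          {x : EuclideanSpace ℝ (Fin 5) | MvPolynomial.eval (WithLp.ofLp x) p = 1} ∧
        MvPolynomial.weightedTotalDegree (![0, 1, 1, 1, 1, 1] : Fin 6 → ℕ) G ≤ 4 := by
  sorry

/-- **Stub 4 (star level to round sphere; M, theorem-level).**  For a positive definite quartic
form `p` on `ℝ⁵` there is a bounded nonsingular polynomial path whose slice `0` has zero set the
unit sphere and whose slice `1` has zero set the star level `{p = 1}`: take
`G = (1 - t)(|x|⁴ - 1) + t(p - 1) = q_t - 1`, `q_t = (1 - t)|x|⁴ + t·p` a positive definite quartic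
form for `t ∈ [0,1]`; on the slice, Euler's identity `∑ xᵢ ∂ᵢq_t = 4q_t = 4`
(`MvPolynomial.IsHomogeneous.sum_X_mul_pderiv`) forbids `∇ₓG = 0`, and
`q_t(x) ≥ min(1, min_{|v|=1} p(v))·|x|⁴` bounds the slices uniformly; `{|x|⁴ = 1}` is
`Metric.sphere 0 1`.  Leans on: `MvPolynomial.IsHomogeneous`, Euler's identity, `EuclideanSpace.norm_eq`,
`IsCompact.exists_isMinOn` on the unit sphere.  [folklore; Milnor1963 §6 (star-shaped levels)] -/
theorem stub_starToRound :
    ∀ (p : MvPolynomial (Fin 5) ℝ), p.IsHomogeneous 4 →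
      (∀ x : EuclideanSpace ℝ (Fin 5), x ≠ 0 → 0 < MvPolynomial.eval (WithLp.ofLp x) p) →
      ∃ G : MvPolynomial (Fin 6) ℝ,
        (∀ t ∈ Set.Icc (0 : ℝ) 1, ∀ x : EuclideanSpace ℝ (Fin 5),
          MvPolynomial.eval (Fin.cons t (WithLp.ofLp x) : Fin 6 → ℝ) G = 0 →
            ∃ i : Fin 5, MvPolynomial.eval (Fin.cons t (WithLp.ofLp x) : Fin 6 → ℝ)
              (MvPolynomial.pderiv i.succ G) ≠ 0) ∧
        (∃ R : ℝ, ∀ t ∈ Set.Icc (0 : ℝ) 1, ∀ x : EuclideanSpace ℝ (Fin 5),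
          MvPolynomial.eval (Fin.cons t (WithLp.ofLp x) : Fin 6 → ℝ) G = 0 → ‖x‖ ≤ R) ∧
        {x : EuclideanSpace ℝ (Fin 5) |
            MvPolynomial.eval (Fin.cons 0 (WithLp.ofLp x) : Fin 6 → ℝ) G = 0} =
          Metric.sphere (0 : EuclideanSpace ℝ (Fin 5)) 1 ∧
        {x : EuclideanSpace ℝ (Fin 5) |
            MvPolynomial.eval (Fin.cons 1 (WithLp.ofLp x) : Fin 6 → ℝ) G = 0} =
          {x : EuclideanSpace ℝ (Fin 5) | MvPolynomial.eval (WithLp.ofLp x) p = 1} := by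
  sorry

/-- **Composition (kernel-checked, no `sorry` of its own): the crux `QuarticRung` BY NAME from the
four registered stubs, each used by name, and the tree's proved round recognition theorem
`Literature.Geometry.Riemannian.nonempty_diffeomorph_sphere_four_of_range_eq_sphere`.**
Normalise `f ↦ g` (PD top form) and transport the embedding along the path; move `g` to a star
level `{p = 1}` inside the quartic chamber (THE BET) and transport; move `{p = 1}` to the unit
sphere and transport; an embedding onto the round sphere is a diffeomorphism onto `S⁴`. -/
theorem QuarticRung_of :
    Summit.SmoothPoincare4.SmoothPoincare4.Theses.AlgebraicDegree.QuarticRung := by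
  intro S f e hdeg hns hemb hrange
  -- normalise to a positive definite top form, and transport `e` along the path
  obtain ⟨G₁, g, hG₁ns, hG₁bd, hG₁one, hG₁zero, hgdeg, hgtop, hgns⟩ :=
    stub_toDefiniteTop S f e hdeg hns hemb hrange
  obtain ⟨e₁, he₁, hr₁⟩ :=
    stub_pathTransport S G₁ e hG₁ns hG₁bd hemb (by rw [hrange, hG₁one])
  -- THE BET: inside the quartic chamber to a star level `{p = 1}`, and transport
  obtain ⟨G₂, p, hp, hppos, hG₂ns, hG₂bd, hG₂one, hG₂zero, -⟩ :=
    stub_definiteToStar S g e₁ hgdeg hgtop hgns he₁ (by rw [hr₁, hG₁zero])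
  obtain ⟨e₂, he₂, hr₂⟩ :=
    stub_pathTransport S G₂ e₁ hG₂ns hG₂bd he₁ (by rw [hr₁, hG₁zero, hG₂one])
  -- star level to the round sphere, and transport
  obtain ⟨G₃, hG₃ns, hG₃bd, hG₃zero, hG₃one⟩ := stub_starToRound p hp hppos
  obtain ⟨e₃, he₃, hr₃⟩ :=
    stub_pathTransport S G₃ e₂ hG₃ns hG₃bd he₂ (by rw [hr₂, hG₂zero, hG₃one])
  -- an embedding onto the round sphere is a diffeomorphism onto `S⁴` (proved in the tree)
  exact Literature.Geometry.Riemannian.nonempty_diffeomorph_sphere_four_of_range_eq_sphere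
    S.carrier he₃ one_pos (hr₃.trans hG₃zero)

end Summit.SmoothPoincare4.SmoothPoincare4.Cruxes.QuarticRung.Birth

end

-- h21 skeleton audit: the composition concludes the crux by name; sorries only in the four stubs
#h21_check_skeleton "stmt-SmoothPoincare4-3399" Summit.SmoothPoincare4.SmoothPoincare4.Theses.AlgebraicDegree.QuarticRung stub_pathTransport stub_toDefiniteTop stub_definiteToStar stub_starToRound
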